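import Summits.Ventures.HSemireg.WedgeHankelSubstitutionJordan
import Mathlib.Algebra.CharP.Lemmas

/-!
# Venture HSemireg — THE SHEAR ON TH-7's CLASSES IN CHARACTERISTIC `p`: `(SbC(shear λ) − 1)^p = 0`, `(SbC(shear λ) − 1)^{p−1} ≠ 0` once `p ≤ n + 1`, so the MINIMAL
# POLYNOMIAL is `(X − 1)^{min(p, n+1)}` (`λ ≠ 0`) and the nilpotency index of `SbC(shear λ) − 1` is exactly `min(p, n+1)` — the largest Jordan block has size `min(p, n+1)`

HONEST FRAMING. Part of the Lean index of the computation cell `pub-hsemireg` (seat p10 gen 20, Sunday typer «UNIFORM-IN-n»).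
Finite-dimensional EXTERIOR ALGEBRA + linear algebra ONLY: no variety, no cohomology theory, no sheaf, no Ext group, no semiregularity map;
nothing here says that HC / HC_CM / HC_AV holds; no Literature fact is declared or used.  Custodian versions as in `WedgeHankelSiegelIdeal` (1/3) and `WedgeHankelFrameChange`;
the dictionary (the shear = translation of the node `ν ↦ ν + λ` on binary forms; in characteristic `p` the space of forms of degree `≤ n` splits into translation-stable pieces
`℘^k · K[ν]_{<p}`, `℘ = ν^p − λ^{p−1}ν`, giving `⌊n/p⌋` Jordan blocks of size `p` and one of size `n + 1 − p⌊n/p⌋`) is QUOTED, never asserted.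

WHAT IS IN THE TREE.  I18 (`WedgeHankelSubstitutionJordan`): `(SbC(shear λ) − 1)^{n+1} = 0`, `(SbC(shear λ) − 1)^k ≠ 0` for `k ≤ n` with `k!·λ^k ≠ 0`, `minpoly = (X − 1)^{n+1}`
when `n!·λ^n ≠ 0` (ONE Jordan block), `SbC(shear λ)^m = SbC(shear mλ)` and `= 1` when `m = 0` in `K`, and `(SbC(shear λ) − 1)^n = 0` for a prime `p ≤ n` with `p = 0` in `K`
(«not typed: the exact partition»).  THIS FILE (namespace `Summit.Ventures.HSemireg.Wedge.HankelFrameChange` continued; imports I18 + `Mathlib.Algebra.CharP.Lemmas`) pins the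
LARGEST block in characteristic `p` (`[Fact p.Prime] [CharP K p]`):
* §225 `X_sub_C_one_pow_char` (`(X − 1)^p = X^p − 1` in `K[X]`), **`SbC_shear_sub_one_pow_char`: `(SbC(shear λ) − 1)^p = 0`**, `factorial_cast_ne_zero_of_lt_char` (`k < p ⇒ k! ≠ 0` in `K`),
  **`SbC_shear_sub_one_pow_pred_char_ne_zero`** (`λ ≠ 0`, `p ≤ n + 1 ⇒ (SbC(shear λ) − 1)^{p−1} ≠ 0`).
* §226 **`minpoly_SbC_shear_char`: `minpoly (SbC(shear λ)) = (X − 1)^p` for `λ ≠ 0`, `p ≤ n + 1`**, **`minpoly_SbC_shear_char_min`** (`= (X − 1)^{min(p, n+1)}`, every `n`),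
  `minpoly_SbC_shear_charZero` (characteristic `0`: `(X − 1)^{n+1}`, I18 restated through `CharZero`), and **`SbC_shear_sub_one_pow_eq_zero_iff_char`:
  `(SbC(shear λ) − 1)^k = 0 ↔ min(p, n+1) ≤ k`** — the nilpotency index, i.e. the size of the largest Jordan block, is `min(p, n+1)`.
NOT typed here: the number of Jordan blocks (`⌊n/p⌋ + 1 = dim ker(SbC(shear λ) − 1)`) and the full partition `(p, …, p, n + 1 − p⌊n/p⌋)`; anything Ext-side.  New names only.
-/

open Module

namespace Summit.Ventures.HSemireg.Wedge.HankelFrameChange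

open Summit.Ventures.HSemireg.Wedge Summit.Ventures.HSemireg.Wedge.Kunneth Summit.Ventures.HSemireg.Wedge.Hankel
  Summit.Ventures.HSemireg.Wedge.BasisFree Summit.Ventures.HSemireg.Wedge.HankelSiegel Summit.Ventures.HSemireg.Wedge.HankelSiegelIdeal
  Summit.Ventures.HSemireg.Wedge.KunnethKernel Summit.Ventures.HSemireg.Wedge.HankelRankOne Summit.Ventures.HSemireg.Wedge.KernelDuality

variable (K : Type*) [Field K] {n : ℕ}

/-! ## §225. `(SbC(shear λ) − 1)^p = 0` and `(SbC(shear λ) − 1)^{p−1} ≠ 0` in characteristic `p` -/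

/-- in characteristic `p`: `(X − 1)^p = X^p − 1` in `K[X]`. -/
theorem X_sub_C_one_pow_char (p : ℕ) [Fact p.Prime] [CharP K p] :
    (Polynomial.X - Polynomial.C (1 : K)) ^ p = (Polynomial.X : Polynomial K) ^ p - 1 := by
  rw [sub_pow_char, Polynomial.C_1, one_pow]

/-- **`(SbC(shear λ) − 1)^p = 0` ON TH-7's CLASSES IN CHARACTERISTIC `p`** (every `n`, every `λ`): `SbC(shear λ)^p = SbC(shear pλ) = 1` (I18) and `(X − 1)^p = X^p − 1`. -/
theorem SbC_shear_sub_one_pow_char (lam : K) (p : ℕ) [Fact p.Prime] [CharP K p] :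
    (SbC K 1 lam 0 1 - 1) ^ p = (0 : spikeSpan K n →ₗ[K] spikeSpan K n) := by
  have h := SbC_shear_pow_eq_one_of_cast_eq_zero K lam (n := n) (m := p) (CharP.cast_eq_zero K p)
  have e : Polynomial.aeval (SbC K 1 lam 0 1 (n := n)) ((Polynomial.X - Polynomial.C (1 : K)) ^ p) = 0 := by
    rw [X_sub_C_one_pow_char K p, map_sub, map_pow, Polynomial.aeval_X, map_one, h, sub_self]
  rwa [map_pow, map_sub, Polynomial.aeval_X, Polynomial.aeval_C, map_one] at e

omit [Field K] in
/-- `k! ≠ 0` in characteristic `p > k`. -/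
theorem factorial_cast_ne_zero_of_lt_char (K : Type*) [CommRing K] (p : ℕ) [Fact p.Prime] [CharP K p] {k : ℕ} (hk : k < p) : (k.factorial : K) ≠ 0 := by
  rw [Ne, CharP.cast_eq_zero_iff K p, (Fact.out : p.Prime).dvd_factorial, not_le]
  exact hk

/-- **`(SbC(shear λ) − 1)^{p−1} ≠ 0` for `λ ≠ 0` and `p ≤ n + 1`** (characteristic `p`): the `E_{p−1}`-coordinate of its value on `E_0` is `(p−1)!·λ^{p−1} ≠ 0` (I18). -/
theorem SbC_shear_sub_one_pow_pred_char_ne_zero {lam : K} (hlam : lam ≠ 0) (p : ℕ) [Fact p.Prime] [CharP K p] (hpn : p ≤ n + 1) :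
    (SbC K 1 lam 0 1 - 1) ^ (p - 1) ≠ (0 : spikeSpan K n →ₗ[K] spikeSpan K n) := by
  have hp : p.Prime := Fact.out
  exact SbC_shear_sub_one_pow_ne_zero K lam (by omega)
    (mul_ne_zero (factorial_cast_ne_zero_of_lt_char K p (Nat.sub_lt hp.pos one_pos)) (pow_ne_zero _ hlam))

/-! ## §226. The minimal polynomial and the nilpotency index in characteristic `p` -/

/-- **THE MINIMAL POLYNOMIAL OF THE SHEAR ON THE CLASSES IN CHARACTERISTIC `p ≤ n + 1`: `(X − 1)^p`** (`λ ≠ 0`) — the largest Jordan block has size EXACTLY `p`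
(compare I18 `minpoly_SbC_shear`: `(X − 1)^{n+1}`, one block, when `p > n`). -/
theorem minpoly_SbC_shear_char {lam : K} (hlam : lam ≠ 0) (p : ℕ) [Fact p.Prime] [CharP K p] (hpn : p ≤ n + 1) :
    minpoly K (SbC K 1 lam 0 1 (n := n)) = (Polynomial.X - Polynomial.C 1) ^ p := by
  have hirr : Irreducible (Polynomial.X - Polynomial.C (1 : K)) := Polynomial.irreducible_X_sub_C 1
  have hdvd : minpoly K (SbC K 1 lam 0 1 (n := n)) ∣ (Polynomial.X - Polynomial.C 1) ^ p := minpoly.dvd K _ (by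
    rw [map_pow, map_sub, Polynomial.aeval_X, Polynomial.aeval_C, map_one, SbC_shear_sub_one_pow_char])
  obtain ⟨j, hj, hassoc⟩ := (dvd_prime_pow hirr.prime _).1 hdvd
  have heq : minpoly K (SbC K 1 lam 0 1 (n := n)) = (Polynomial.X - Polynomial.C 1) ^ j :=
    Polynomial.eq_of_monic_of_associated (minpoly.monic (LinearMap.isIntegral _)) ((Polynomial.monic_X_sub_C (1 : K)).pow j) hassoc
  rcases Nat.lt_or_ge j p with hlt | hge
  · exfalso
    have h0 : (SbC K 1 lam 0 1 (n := n) - 1) ^ j = 0 := by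
      have := minpoly.aeval K (SbC K 1 lam 0 1 (n := n))
      rwa [heq, map_pow, map_sub, Polynomial.aeval_X, Polynomial.aeval_C, map_one] at this
    exact SbC_shear_sub_one_pow_pred_char_ne_zero K hlam p hpn (pow_eq_zero_of_le (by omega) h0)
  · rw [heq, le_antisymm hj hge]

/-- **`minpoly (SbC(shear λ)) = (X − 1)^{min(p, n+1)}` IN CHARACTERISTIC `p`, for every `n`** (`λ ≠ 0`; §226 for `p ≤ n + 1`, I18 for `p > n`). -/
theorem minpoly_SbC_shear_char_min {lam : K} (hlam : lam ≠ 0) (p : ℕ) [Fact p.Prime] [CharP K p] :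
    minpoly K (SbC K 1 lam 0 1 (n := n)) = (Polynomial.X - Polynomial.C 1) ^ min p (n + 1) := by
  rcases le_or_gt p (n + 1) with h | h
  · rw [min_eq_left h, minpoly_SbC_shear_char K hlam p h]
  · rw [min_eq_right h.le]
    exact minpoly_SbC_shear K lam (mul_ne_zero (factorial_cast_ne_zero_of_lt_char K p (by omega)) (pow_ne_zero _ hlam))

/-- characteristic `0`: `minpoly (SbC(shear λ)) = (X − 1)^{n+1}` for every `λ ≠ 0` (I18 `minpoly_SbC_shear`, `n! ≠ 0`). -/
theorem minpoly_SbC_shear_charZero [CharZero K] {lam : K} (hlam : lam ≠ 0) :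
    minpoly K (SbC K 1 lam 0 1 (n := n)) = (Polynomial.X - Polynomial.C 1) ^ (n + 1) :=
  minpoly_SbC_shear K lam (mul_ne_zero (Nat.cast_ne_zero.2 (Nat.factorial_ne_zero n)) (pow_ne_zero _ hlam))

/-- **THE NILPOTENCY INDEX IN CHARACTERISTIC `p`: `(SbC(shear λ) − 1)^k = 0 ↔ min(p, n+1) ≤ k`** (`λ ≠ 0`) — the largest Jordan block of the shear on th-7's classes has
size `min(p, n+1)`. -/
theorem SbC_shear_sub_one_pow_eq_zero_iff_char {lam : K} (hlam : lam ≠ 0) (p : ℕ) [Fact p.Prime] [CharP K p] (k : ℕ) :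
    (SbC K 1 lam 0 1 - 1) ^ k = (0 : spikeSpan K n →ₗ[K] spikeSpan K n) ↔ min p (n + 1) ≤ k := by
  constructor
  · intro h
    by_contra hlt
    rw [not_le, lt_min_iff] at hlt
    exact SbC_shear_sub_one_pow_ne_zero K lam (show k ≤ n by omega)
      (mul_ne_zero (factorial_cast_ne_zero_of_lt_char K p hlt.1) (pow_ne_zero _ hlam)) h
  · intro h
    rcases le_or_gt p (n + 1) with hp | hp
    · rw [min_eq_left hp] at h
      exact pow_eq_zero_of_le h (SbC_shear_sub_one_pow_char K lam p)
    · rw [min_eq_right hp.le] at h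
      exact pow_eq_zero_of_le h (SbC_shear_sub_one_pow_succ K lam)

end Summit.Ventures.HSemireg.Wedge.HankelFrameChange
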